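import Mathlib
import HarnessLib

/-!
HONEST FRAMING: exact (Metropolis-corrected) sampling algorithms for lattice gauge theory; figures
of merit are autocorrelation/cost numbers at stated couplings and volumes; no continuum-physics
claim.

# StaleTwoMomentSequences — THE TWO-MOMENT BOUNDS OF THE STALE POTENTIAL AS A PURE REAL-SEQUENCE LEMMA: FROM `a_n = F_n + t·b_n`, `a_{n+1} = a_n − λF_n`, `b_{n+1} = κF_n`,
# `q_{n+1} ≤ (1−2λ)q_n + C₁F_n + C₂b_n`, `q_0 = a_0²`: `a_n ≥ (1−λ)ⁿa_0` AND `q_n − a_n² ≤ (γ/λ)(1−λ)ⁿ + δ/(2λ)` WITH `γ = C₁a_0 + C₂(κa_0/(1−λ) + b_0)`, `δ = (C₁ + C₂κ)·t(b_0 + κa_0)`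
# — THE VARIANCE STAYS OF THE ORDER OF THE MEAN (lean-2 GEN-45, ours)

Venture-side (OURS).  Cell `lqcd-flow` (pub-lqcd), unit `pub-lqcd-lean-2-g45`, 2026-08-31.  Chapter AE, file 9 — the algebra behind file 10's coupon-collector concentration in the ceiling's
unit `K/(t(1−t))`.  Companion of `Scaling/UnitSurvivalLogFloor.twoMoment_bounds` (GEN-27: the same recursions for PLANTED VALUES, with leakage terms `ν_s` and the start `a_0 = K`,
`b_0 = 0`); here the leakage is absent (the stale set cannot be re-planted) and the start is general (`b_0 ≥ 0`: the hub may start stale), and the conclusion is stated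
directly as a bound on `q_n − a_n²` against the first moment from below — what Chebyshev consumes.

* **`stale_twoMoment_bounds`** — `0 < λ`, `2λ ≤ 1`, `0 ≤ t`, `κ, C₁, C₂ ≥ 0`, `a_0 ≥ 0`, `b_0 ≥ 0`, `q_0 = a_0²`, `F, b ≥ 0` and the four relations ⇒ for every `n`:
  `(1−λ)ⁿa_0 ≤ a_n` and `q_n − a_n² ≤ (C₁a_0 + C₂(κa_0/(1−λ) + b_0))·(1−λ)ⁿ/λ + (C₁ + C₂κ)·t(b_0 + κa_0)/(2λ)`.

Reading (no numerics implied): with `λ = t(1−t)/K`, `κ = t/K`, `C₁ = λ(1−t)`, `C₂ = 3t(1−t) + 2λt²`, `a_0 = K + t` (file 10) the right side is `≤ 16·(1−λ)ⁿa_0 + 9`: the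
number of stale levels of the idealised star has variance of the order of its mean up to the coupon-collector time, so it stays above half its mean in probability.  Literature
grade (cell rule): OWN, elementary; nothing cited as a fact; no new bib keys.
-/

namespace Summit.Ventures.LatticeQCDFlow.Scaling

/-- **THE TWO-MOMENT BOUNDS (pure real sequences, no leakage, general start).** [ours] -/
theorem stale_twoMoment_bounds {a b q F : ℕ → ℝ} {t lam kap C₁ C₂ : ℝ} (ht0 : 0 ≤ t) (hlam0 : 0 < lam) (hlam2 : 2 * lam ≤ 1)
    (hkap : 0 ≤ kap) (hC₁ : 0 ≤ C₁) (hC₂ : 0 ≤ C₂) (ha0 : 0 ≤ a 0) (hb00 : 0 ≤ b 0) (hq0 : q 0 = a 0 ^ 2)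
    (hb_nn : ∀ n, 0 ≤ b n) (hF0 : ∀ n, 0 ≤ F n) (hFa : ∀ n, a n = F n + t * b n)
    (hstepA : ∀ n, a (n + 1) = a n - lam * F n) (hstepB : ∀ n, b (n + 1) = kap * F n)
    (hstepQ : ∀ n, q (n + 1) ≤ (1 - 2 * lam) * q n + C₁ * F n + C₂ * b n) (n : ℕ) :
    (1 - lam) ^ n * a 0 ≤ a n ∧
      q n - a n ^ 2 ≤ (C₁ * a 0 + C₂ * (kap * a 0 / (1 - lam) + b 0)) * (1 - lam) ^ n / lam + (C₁ + C₂ * kap) * (t * (b 0 + kap * a 0)) / (2 * lam) := by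
  have h1lam : 0 < 1 - lam := by linarith
  have h12lam : 0 ≤ 1 - 2 * lam := by linarith
  -- (1) `F ≤ a`, `a ≥ 0`, `a` non-increasing, `a ≤ a₀`
  have hFle : ∀ n, F n ≤ a n := fun n => by rw [hFa n]; nlinarith [hb_nn n]
  have ha_nn : ∀ n, 0 ≤ a n := fun n => le_trans (hF0 n) (hFle n)
  have ha_mono : ∀ n, a (n + 1) ≤ a n := fun n => by rw [hstepA n]; nlinarith [hF0 n]
  have ha_le0 : ∀ n, a n ≤ a 0 := by
    intro n; induction n with
    | zero => exact le_rfl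
    | succ n ih => exact (ha_mono n).trans ih
  -- (2) the first moment from below
  have hlow : ∀ n, (1 - lam) ^ n * a 0 ≤ a n := by
    intro n; induction n with
    | zero => simp
    | succ n ih =>
        have h1 : (1 - lam) * a n ≤ a (n + 1) := by rw [hstepA n]; nlinarith [hFle n, ha_nn n]
        calc (1 - lam) ^ (n + 1) * a 0 = (1 - lam) * ((1 - lam) ^ n * a 0) := by ring
          _ ≤ (1 - lam) * a n := mul_le_mul_of_nonneg_left ih h1lam.le
          _ ≤ a (n + 1) := h1
  refine ⟨hlow n, ?_⟩
  -- (3) `b ≤ b₀ + κa₀`, `a_n ≤ (1−λ)ⁿa₀ + A`, `b_n ≤ (κa₀/(1−λ) + b₀)(1−λ)ⁿ + κA`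
  set A : ℝ := t * (b 0 + kap * a 0) with hA
  have hA0 : 0 ≤ A := mul_nonneg ht0 (add_nonneg hb00 (mul_nonneg hkap ha0))
  have hb_le : ∀ n, b n ≤ b 0 + kap * a 0 := by
    intro n; cases n with
    | zero => nlinarith [mul_nonneg hkap ha0]
    | succ n => rw [hstepB n]; nlinarith [mul_le_mul_of_nonneg_left ((hFle n).trans (ha_le0 n)) hkap, hb00]
  have ha_up : ∀ n, a n ≤ (1 - lam) ^ n * a 0 + A := by
    intro n; induction n with
    | zero => simp [hA0]
    | succ n ih =>
        have h1 : a (n + 1) = (1 - lam) * a n + lam * t * b n := by rw [hstepA n, hFa n]; ring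
        rw [h1]
        have h2 : lam * t * b n ≤ lam * A := by
          rw [hA]; have := mul_le_mul_of_nonneg_left (hb_le n) (mul_nonneg hlam0.le ht0); nlinarith
        have h3 : (1 - lam) * a n ≤ (1 - lam) * ((1 - lam) ^ n * a 0 + A) := mul_le_mul_of_nonneg_left ih h1lam.le
        calc (1 - lam) * a n + lam * t * b n ≤ (1 - lam) * ((1 - lam) ^ n * a 0 + A) + lam * A := add_le_add h3 h2
          _ = (1 - lam) ^ (n + 1) * a 0 + A := by ring
  have hb_up : ∀ n, b n ≤ (kap * a 0 / (1 - lam) + b 0) * (1 - lam) ^ n + kap * A := by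
    intro n; cases n with
    | zero =>
        simp only [pow_zero, mul_one]
        have : 0 ≤ kap * a 0 / (1 - lam) := div_nonneg (mul_nonneg hkap ha0) h1lam.le
        nlinarith [mul_nonneg hkap hA0]
    | succ n =>
        rw [hstepB n]
        have h1 : kap * F n ≤ kap * ((1 - lam) ^ n * a 0 + A) := mul_le_mul_of_nonneg_left ((hFle n).trans (ha_up n)) hkap
        have e : kap * ((1 - lam) ^ n * a 0 + A) = kap * a 0 / (1 - lam) * (1 - lam) ^ (n + 1) + kap * A := by
          field_simp; ring
        have h2 : 0 ≤ b 0 * (1 - lam) ^ (n + 1) := mul_nonneg hb00 (pow_nonneg h1lam.le _)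
        nlinarith
  -- (4) the recursion of `r_n = q_n − a_n²` and its supersolution
  set γ : ℝ := C₁ * a 0 + C₂ * (kap * a 0 / (1 - lam) + b 0) with hγ
  set δ : ℝ := (C₁ + C₂ * kap) * A with hδ
  have hγ0 : 0 ≤ γ := add_nonneg (mul_nonneg hC₁ ha0) (mul_nonneg hC₂ (add_nonneg (div_nonneg (mul_nonneg hkap ha0) h1lam.le) hb00))
  have hg : ∀ n, C₁ * F n + C₂ * b n ≤ γ * (1 - lam) ^ n + δ := by
    intro n
    have h1 : C₁ * F n ≤ C₁ * ((1 - lam) ^ n * a 0 + A) := mul_le_mul_of_nonneg_left ((hFle n).trans (ha_up n)) hC₁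
    have h2 : C₂ * b n ≤ C₂ * ((kap * a 0 / (1 - lam) + b 0) * (1 - lam) ^ n + kap * A) := mul_le_mul_of_nonneg_left (hb_up n) hC₂
    rw [hγ, hδ]; nlinarith
  have hrstep : ∀ n, q (n + 1) - a (n + 1) ^ 2 ≤ (1 - 2 * lam) * (q n - a n ^ 2) + (γ * (1 - lam) ^ n + δ) := by
    intro n
    have h1 : (1 - lam) * a n ≤ a (n + 1) := by rw [hstepA n]; nlinarith [hFle n, ha_nn n]
    have h2 : (1 - 2 * lam) * a n ^ 2 ≤ a (n + 1) ^ 2 := by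
      have h3 : (1 - lam) ^ 2 * a n ^ 2 ≤ a (n + 1) ^ 2 := by
        rw [← mul_pow]; exact pow_le_pow_left₀ (mul_nonneg h1lam.le (ha_nn n)) h1 2
      nlinarith [sq_nonneg (a n), sq_nonneg lam]
    nlinarith [hstepQ n, hg n]
  -- supersolution `R_n = (γ/λ)((1−λ)ⁿ − (1−2λ)ⁿ) + (δ/(2λ))(1 − (1−2λ)ⁿ)`
  have hR : ∀ n, q n - a n ^ 2 ≤ γ / lam * ((1 - lam) ^ n - (1 - 2 * lam) ^ n) + δ / (2 * lam) * (1 - (1 - 2 * lam) ^ n) := by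
    intro n; induction n with
    | zero => rw [hq0]; simp
    | succ n ih =>
        have e : γ / lam * ((1 - lam) ^ (n + 1) - (1 - 2 * lam) ^ (n + 1)) + δ / (2 * lam) * (1 - (1 - 2 * lam) ^ (n + 1))
            = (1 - 2 * lam) * (γ / lam * ((1 - lam) ^ n - (1 - 2 * lam) ^ n) + δ / (2 * lam) * (1 - (1 - 2 * lam) ^ n)) + (γ * (1 - lam) ^ n + δ) := by
          field_simp; ring
        rw [e]
        have h3 := mul_le_mul_of_nonneg_left ih h12lam
        linarith [hrstep n]
  refine (hR n).trans ?_
  have h1 : γ / lam * ((1 - lam) ^ n - (1 - 2 * lam) ^ n) ≤ γ * (1 - lam) ^ n / lam := by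
    rw [div_mul_eq_mul_div]
    refine div_le_div_of_nonneg_right ?_ hlam0.le
    nlinarith [pow_nonneg h12lam n]
  have h2 : δ / (2 * lam) * (1 - (1 - 2 * lam) ^ n) ≤ δ / (2 * lam) := by
    have hδ0 : 0 ≤ δ / (2 * lam) := div_nonneg (mul_nonneg (add_nonneg hC₁ (mul_nonneg hC₂ hkap)) hA0) (by linarith)
    nlinarith [pow_nonneg h12lam n]
  have h3 : γ * (1 - lam) ^ n / lam + δ / (2 * lam)
      = (C₁ * a 0 + C₂ * (kap * a 0 / (1 - lam) + b 0)) * (1 - lam) ^ n / lam + (C₁ + C₂ * kap) * (t * (b 0 + kap * a 0)) / (2 * lam) := by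
    rw [hγ, hδ, hA]
  linarith

end Summit.Ventures.LatticeQCDFlow.Scaling
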